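import Summits.Ventures.PercRepro.RankLevelSetAC
import Summits.Ventures.PercRepro.RankLevelSetB
import Summits.Ventures.PercRepro.RankLevelSetF

/-!
# PercRepro — C-025 «RANK LEVEL-SET INEQUALITY»: Theorem B, `q = 1`, for EVERY finite matroid (p3, gen 6)

Mine-2's Theorem B (`proofs/MINE2-RLS.md` §3): `Φ(p,1)·#U(p,1) ≤ #Y(p,1)` for every matroid and every `p`
(the `C025` body at `q = 1`). The paper proof reduces to simple matroids through parallel classes; here the
reduction is replaced by a strong induction on `|E|` for all `p` at once, with three cases:

* a LOOP `e`: both counts halve (`ncard_U_eq_two_mul_of_loop`, `ncard_Y_eq_two_mul_of_loop` —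
  `S ↦ S ∖ {e}` pairs the sets containing `e` with those avoiding it, ranks unchanged);
* a PARALLEL PAIR `e ∈ cl{e′}` (no loop): the single-element step `c025_step_of_delete_contract`
  (`RankLevelSetF`) with `spans_of_parallel`, from the induction hypothesis on `M ＼ {e}` at `(p, 1)` and
  Theorem A `c025_of_q_zero` on `M ／ {e}` at `(p − 1, 0)` (`RankLevelSetAC`, loops allowed);
* SIMPLE `M` (every `≤ 2`-subset independent): the level-wise Theorem B′ `c025_levelwise_q_one_of_simple`
  (`RankLevelSetB`) summed over `1 < u < p` (`c025_of_q_one_of_simple`).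
`exists_loop_or_parallel_of_not_simple` provides the case split.
* **`c025_of_q_one`** — the theorem, set-builders as in `C025`. Axioms: standard.
-/

open scoped Matroid

namespace PercRepro

open Set Finset

variable {α : Type} {M : Matroid α}

/-- A loop adds nothing to the rank of a subset of the ground set. -/
lemma eRk_insert_loop_eq {e : α} (he : e ∈ M.loops) {X : Set α} (hX : X ⊆ M.E) :
    M.eRk (insert e X) = M.eRk X :=
  eRk_insert_eq_of_mem_closure hX (M.closure_mono (empty_subset X) he)

/-- For a loop `e`: `#U_M(p,q) = 2 · #U_{M ＼ {e}}(p,q)`. -/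
lemma ncard_U_eq_two_mul_of_loop [M.Finite] {e : α} (he : e ∈ M.loops) (p q : ℕ) :
    {A : Set α | A ⊆ M.E ∧ M.eRk A = (p : ℕ∞) ∧ M.eRk (M.E \ A) = (q : ℕ∞)}.ncard =
      2 * {A : Set α | A ⊆ (M ＼ {e}).E ∧ (M ＼ {e}).eRk A = (p : ℕ∞) ∧
        (M ＼ {e}).eRk ((M ＼ {e}).E \ A) = (q : ℕ∞)}.ncard := by
  have hEfin : M.E.Finite := M.set_finite M.E
  have heE : e ∈ M.E := M.loops_subset_ground he
  have hE' : (M ＼ {e}).E = M.E \ {e} := Matroid.delete_ground M {e}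
  set U' := {A : Set α | A ⊆ (M ＼ {e}).E ∧ (M ＼ {e}).eRk A = (p : ℕ∞) ∧
    (M ＼ {e}).eRk ((M ＼ {e}).E \ A) = (q : ℕ∞)} with hU'
  have hU'fin : U'.Finite := (hEfin.subset sdiff_subset).finite_subsets.subset (fun A hA => hA.1)
  -- the complement identities
  have hcompl₁ : ∀ A ⊆ M.E \ {e}, M.E \ A = insert e ((M.E \ {e}) \ A) := by
    intro A hA
    ext x
    simp only [mem_sdiff, mem_singleton_iff, mem_insert_iff]
    constructor
    · rintro ⟨hxE, hxA⟩
      by_cases hxe : x = e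
      · exact Or.inl hxe
      · exact Or.inr ⟨⟨hxE, hxe⟩, hxA⟩
    · rintro (rfl | ⟨⟨hxE, -⟩, hxA⟩)
      · exact ⟨heE, fun h => (hA h).2 rfl⟩
      · exact ⟨hxE, hxA⟩
  have hcompl₂ : ∀ A ⊆ M.E \ {e}, M.E \ insert e A = (M.E \ {e}) \ A := by
    intro A _
    ext x
    simp only [mem_sdiff, mem_singleton_iff, mem_insert_iff]
    tauto
  have hmem : ∀ A, A ∈ U' ↔ A ⊆ M.E \ {e} ∧ M.eRk A = (p : ℕ∞) ∧ M.eRk ((M.E \ {e}) \ A) = (q : ℕ∞) := by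
    intro A
    rw [hU', mem_setOf_eq, hE']
    constructor
    · rintro ⟨hA, h1, h2⟩
      rw [delete_singleton_eRk_eq hA] at h1
      rw [delete_singleton_eRk_eq sdiff_subset] at h2
      exact ⟨hA, h1, h2⟩
    · rintro ⟨hA, h1, h2⟩
      rw [delete_singleton_eRk_eq hA, delete_singleton_eRk_eq sdiff_subset]
      exact ⟨hA, h1, h2⟩
  have hsplit : {A : Set α | A ⊆ M.E ∧ M.eRk A = (p : ℕ∞) ∧ M.eRk (M.E \ A) = (q : ℕ∞)} =
      U' ∪ (fun A => insert e A) '' U' := by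
    ext A
    constructor
    · rintro ⟨hA, hpA, hqA⟩
      by_cases heA : e ∈ A
      · have hA'E : A \ {e} ⊆ M.E \ {e} := sdiff_subset_sdiff_left hA
        refine Or.inr ⟨A \ {e}, (hmem _).2 ⟨hA'E, ?_, ?_⟩, ?_⟩
        · rw [← hpA, ← eRk_insert_loop_eq he (hA'E.trans sdiff_subset), insert_sdiff_singleton,
            insert_eq_of_mem heA]
        · rw [← hcompl₂ _ hA'E, insert_sdiff_singleton, insert_eq_of_mem heA, hqA]
        · simp only
          rw [insert_sdiff_singleton, insert_eq_of_mem heA]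
      · have hAE : A ⊆ M.E \ {e} := fun x hx => ⟨hA hx, fun hxe => heA (hxe ▸ hx)⟩
        refine Or.inl ((hmem _).2 ⟨hAE, hpA, ?_⟩)
        rw [← hqA, hcompl₁ _ hAE, eRk_insert_loop_eq he (sdiff_subset.trans sdiff_subset)]
    · rintro (hA | ⟨A', hA', rfl⟩)
      · obtain ⟨hAE, hpA, hqA⟩ := (hmem _).1 hA
        refine ⟨hAE.trans sdiff_subset, hpA, ?_⟩
        rw [hcompl₁ _ hAE, eRk_insert_loop_eq he (sdiff_subset.trans sdiff_subset), hqA]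
      · obtain ⟨hAE, hpA, hqA⟩ := (hmem _).1 hA'
        refine ⟨insert_subset heE (hAE.trans sdiff_subset), ?_, ?_⟩
        · rw [eRk_insert_loop_eq he (hAE.trans sdiff_subset), hpA]
        · rw [hcompl₂ _ hAE, hqA]
  have hinj : InjOn (fun A => insert e A) U' := by
    intro A hA A' hA' hEq
    have h1 : e ∉ A := fun h => (((hmem _).1 hA).1 h).2 rfl
    have h2 : e ∉ A' := fun h => (((hmem _).1 hA').1 h).2 rfl
    simp only at hEq
    rw [← insert_sdiff_self_of_notMem h1, ← insert_sdiff_self_of_notMem h2, hEq]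
  have hdisj : Disjoint U' ((fun A => insert e A) '' U') := by
    rw [Set.disjoint_left]
    rintro A hA ⟨A', -, rfl⟩
    exact (((hmem _).1 hA).1 (mem_insert e A')).2 rfl
  rw [hsplit, ncard_union_eq hdisj hU'fin (hU'fin.image _), hinj.ncard_image]
  ring

/-- For a loop `e`: `#Y_M(p,q) = 2 · #Y_{M ＼ {e}}(p,q)`. -/
lemma ncard_Y_eq_two_mul_of_loop [M.Finite] {e : α} (he : e ∈ M.loops) (p q : ℕ) :
    {A : Set α | A ⊆ M.E ∧ (q : ℕ∞) < M.eRk A ∧ M.eRk A < (p : ℕ∞)}.ncard =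
      2 * {A : Set α | A ⊆ (M ＼ {e}).E ∧ (q : ℕ∞) < (M ＼ {e}).eRk A ∧
        (M ＼ {e}).eRk A < (p : ℕ∞)}.ncard := by
  have hEfin : M.E.Finite := M.set_finite M.E
  have heE : e ∈ M.E := M.loops_subset_ground he
  have hE' : (M ＼ {e}).E = M.E \ {e} := Matroid.delete_ground M {e}
  set Y' := {A : Set α | A ⊆ (M ＼ {e}).E ∧ (q : ℕ∞) < (M ＼ {e}).eRk A ∧
    (M ＼ {e}).eRk A < (p : ℕ∞)} with hY'
  have hY'fin : Y'.Finite := (hEfin.subset sdiff_subset).finite_subsets.subset (fun A hA => hA.1)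
  have hmem : ∀ A, A ∈ Y' ↔ A ⊆ M.E \ {e} ∧ (q : ℕ∞) < M.eRk A ∧ M.eRk A < (p : ℕ∞) := by
    intro A
    rw [hY', mem_setOf_eq, hE']
    constructor
    · rintro ⟨hA, h1, h2⟩
      rw [delete_singleton_eRk_eq hA] at h1 h2
      exact ⟨hA, h1, h2⟩
    · rintro ⟨hA, h1, h2⟩
      rw [delete_singleton_eRk_eq hA]
      exact ⟨hA, h1, h2⟩
  have hsplit : {A : Set α | A ⊆ M.E ∧ (q : ℕ∞) < M.eRk A ∧ M.eRk A < (p : ℕ∞)} =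
      Y' ∪ (fun A => insert e A) '' Y' := by
    ext A
    constructor
    · rintro ⟨hA, h1, h2⟩
      by_cases heA : e ∈ A
      · have hA'E : A \ {e} ⊆ M.E \ {e} := sdiff_subset_sdiff_left hA
        have hr : M.eRk (A \ {e}) = M.eRk A := by
          rw [← eRk_insert_loop_eq he (hA'E.trans sdiff_subset), insert_sdiff_singleton,
            insert_eq_of_mem heA]
        refine Or.inr ⟨A \ {e}, (hmem _).2 ⟨hA'E, hr ▸ h1, hr ▸ h2⟩, ?_⟩
        simp only
        rw [insert_sdiff_singleton, insert_eq_of_mem heA]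
      · have hAE : A ⊆ M.E \ {e} := fun x hx => ⟨hA hx, fun hxe => heA (hxe ▸ hx)⟩
        exact Or.inl ((hmem _).2 ⟨hAE, h1, h2⟩)
    · rintro (hA | ⟨A', hA', rfl⟩)
      · obtain ⟨hAE, h1, h2⟩ := (hmem _).1 hA
        exact ⟨hAE.trans sdiff_subset, h1, h2⟩
      · obtain ⟨hAE, h1, h2⟩ := (hmem _).1 hA'
        refine ⟨insert_subset heE (hAE.trans sdiff_subset), ?_, ?_⟩
        · rw [eRk_insert_loop_eq he (hAE.trans sdiff_subset)]; exact h1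
        · rw [eRk_insert_loop_eq he (hAE.trans sdiff_subset)]; exact h2
  have hinj : InjOn (fun A => insert e A) Y' := by
    intro A hA A' hA' hEq
    have h1 : e ∉ A := fun h => (((hmem _).1 hA).1 h).2 rfl
    have h2 : e ∉ A' := fun h => (((hmem _).1 hA').1 h).2 rfl
    simp only at hEq
    rw [← insert_sdiff_self_of_notMem h1, ← insert_sdiff_self_of_notMem h2, hEq]
  have hdisj : Disjoint Y' ((fun A => insert e A) '' Y') := by
    rw [Set.disjoint_left]
    rintro A hA ⟨A', -, rfl⟩
    exact (((hmem _).1 hA).1 (mem_insert e A')).2 rfl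
  rw [hsplit, ncard_union_eq hdisj hY'fin (hY'fin.image _), hinj.ncard_image]
  ring

/-- A finite matroid that is not simple has a loop or a parallel pair `e ∈ cl{e′}` of distinct non-loops. -/
lemma exists_loop_or_parallel_of_not_simple
    (h : ¬ ∀ T ⊆ M.E, T.encard ≤ 2 → M.Indep T) :
    (∃ e ∈ M.loops, True) ∨
      ∃ e e', e ∈ M.E ∧ e' ∈ M.E ∧ e' ≠ e ∧ M.Indep {e} ∧ e ∈ M.closure {e'} := by
  push Not at h
  obtain ⟨T, hT, hTcard, hTdep⟩ := h
  by_cases h2 : T.encard = 2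
  · obtain ⟨x, y, hxy, rfl⟩ := encard_eq_two.1 h2
    have hxE : x ∈ M.E := hT (by simp)
    have hyE : y ∈ M.E := hT (by simp)
    by_cases hx : M.Indep {x}
    · by_cases hy : M.Indep {y}
      · refine Or.inr ⟨x, y, hxE, hyE, hxy.symm, hx, ?_⟩
        rw [hy.mem_closure_iff_of_notMem (by simpa using hxy), Matroid.dep_iff]
        exact ⟨hTdep, hT⟩
      · refine Or.inl ⟨y, ?_, trivial⟩
        rw [← Matroid.isLoop_iff, ← Matroid.not_isNonloop_iff hyE, ← Matroid.indep_singleton]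
        exact hy
    · refine Or.inl ⟨x, ?_, trivial⟩
      rw [← Matroid.isLoop_iff, ← Matroid.not_isNonloop_iff hxE, ← Matroid.indep_singleton]
      exact hx
  · have h1 : T.encard ≤ 1 := by
      rcases lt_or_eq_of_le hTcard with h | h
      · exact Order.le_of_lt_add_one (by rwa [show (1 : ℕ∞) + 1 = 2 by norm_num])
      · exact absurd h h2
    rcases encard_le_one_iff_eq.1 h1 with rfl | ⟨x, rfl⟩
    · exact absurd M.empty_indep hTdep
    · have hxE : x ∈ M.E := hT (mem_singleton x)
      refine Or.inl ⟨x, ?_, trivial⟩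
      rw [← Matroid.isLoop_iff, ← Matroid.not_isNonloop_iff hxE, ← Matroid.indep_singleton]
      exact hTdep

/-- `Σ_{q<u<p} W_u ≤ #Y(p,q)`: the rank-`u` subsets of `E` with `q < u < p` lie in `Y(p,q)`. -/
lemma sum_ncard_rank_le_ncard_Y [M.Finite] (p q : ℕ) :
    ∑ u ∈ Finset.Ioo q p, {S : Set α | S ⊆ M.E ∧ M.eRk S = (u : ℕ∞)}.ncard ≤
      {A : Set α | A ⊆ M.E ∧ (q : ℕ∞) < M.eRk A ∧ M.eRk A < (p : ℕ∞)}.ncard := by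
  classical
  have hEfin : M.E.Finite := M.set_finite M.E
  let s : ℕ → Finset (Finset α) := fun u =>
    hEfin.toFinset.powerset.filter (fun S => M.eRk (S : Set α) = (u : ℕ∞))
  have hmem_s : ∀ u (S : Finset α), S ∈ s u ↔ (S : Set α) ⊆ M.E ∧ M.eRk (S : Set α) = (u : ℕ∞) := by
    intro u S
    simp only [s, Finset.mem_filter, Finset.mem_powerset]
    constructor
    · rintro ⟨h1, h2⟩
      exact ⟨fun y hy => hEfin.mem_toFinset.1 (h1 hy), h2⟩
    · rintro ⟨h1, h2⟩
      exact ⟨fun y hy => hEfin.mem_toFinset.2 (h1 hy), h2⟩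
  have hscard : ∀ u, (s u).card = {S : Set α | S ⊆ M.E ∧ M.eRk S = (u : ℕ∞)}.ncard := by
    intro u
    have himg : {S : Set α | S ⊆ M.E ∧ M.eRk S = (u : ℕ∞)} =
        (fun S : Finset α => (S : Set α)) '' ↑(s u) := by
      ext S
      constructor
      · rintro ⟨hSE, hSu⟩
        have hSfin : S.Finite := hEfin.subset hSE
        refine ⟨hSfin.toFinset, ?_, hSfin.coe_toFinset⟩
        rw [Finset.mem_coe, hmem_s, hSfin.coe_toFinset]
        exact ⟨hSE, hSu⟩
      · rintro ⟨S', hS', rfl⟩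
        rw [Finset.mem_coe, hmem_s] at hS'
        exact hS'
    rw [himg, ncard_image_of_injective _ Finset.coe_injective, ncard_coe_finset]
  set F : Finset (Finset α) := (Finset.Ioo q p).biUnion s with hF
  have hFcard : F.card = ∑ u ∈ Finset.Ioo q p, (s u).card := by
    rw [hF, Finset.card_biUnion]
    intro u _ v _ huv
    change Disjoint _ _
    rw [Finset.disjoint_left]
    intro S hS hS'
    rw [hmem_s] at hS hS'
    exact huv (by exact_mod_cast hS.2.symm.trans hS'.2)
  have hYfin : {A : Set α | A ⊆ M.E ∧ (q : ℕ∞) < M.eRk A ∧ M.eRk A < (p : ℕ∞)}.Finite :=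
    hEfin.finite_subsets.subset (fun A hA => hA.1)
  have key : ((F : Set (Finset α))).ncard ≤
      {A : Set α | A ⊆ M.E ∧ (q : ℕ∞) < M.eRk A ∧ M.eRk A < (p : ℕ∞)}.ncard := by
    refine ncard_le_ncard_of_injOn (fun S => (S : Set α)) ?_ ?_ hYfin
    · intro S hS
      rw [Finset.mem_coe, hF, Finset.mem_biUnion] at hS
      obtain ⟨u, hu, hS⟩ := hS
      rw [hmem_s] at hS
      rw [Finset.mem_Ioo] at hu
      refine ⟨hS.1, ?_, ?_⟩
      · rw [hS.2]; exact_mod_cast hu.1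
      · rw [hS.2]; exact_mod_cast hu.2
    · intro S _ S' _ hEq
      exact Finset.coe_injective hEq
  rw [ncard_coe_finset, hFcard] at key
  refine le_trans (le_of_eq ?_) key
  exact Finset.sum_congr rfl (fun u _ => by rw [hscard])

/-- **Theorem B for simple matroids, sum form**: `Φ(p,1)·#U(p,1) ≤ #Y(p,1)` when every `≤ 2`-subset of `E`
is independent (the level-wise `c025_levelwise_q_one_of_simple` summed over `1 < u < p`). -/
theorem c025_of_q_one_of_simple [M.Finite] (hsimple : ∀ T ⊆ M.E, T.encard ≤ 2 → M.Indep T) (p : ℕ) :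
    phiK p 1 * ({A : Set α | A ⊆ M.E ∧ M.eRk A = (p : ℕ∞) ∧ M.eRk (M.E \ A) = ((1 : ℕ) : ℕ∞)}.ncard : ℚ) ≤
      ({A : Set α | A ⊆ M.E ∧ ((1 : ℕ) : ℕ∞) < M.eRk A ∧ M.eRk A < (p : ℕ∞)}.ncard : ℚ) := by
  have hsum := sum_ncard_rank_le_ncard_Y (M := M) p 1
  have hlev : ∀ u ∈ Finset.Ioo 1 p, (p + 1).choose u *
      {A : Set α | A ⊆ M.E ∧ M.eRk A = (p : ℕ∞) ∧ M.eRk (M.E \ A) = ((1 : ℕ) : ℕ∞)}.ncard ≤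
      (p + 1) * {S : Set α | S ⊆ M.E ∧ M.eRk S = (u : ℕ∞)}.ncard := by
    intro u hu
    rw [Finset.mem_Ioo] at hu
    exact c025_levelwise_q_one_of_simple hsimple p u (by omega) (by omega)
  have hN : (∑ u ∈ Finset.Ioo 1 p, (p + 1).choose u) *
      {A : Set α | A ⊆ M.E ∧ M.eRk A = (p : ℕ∞) ∧ M.eRk (M.E \ A) = ((1 : ℕ) : ℕ∞)}.ncard ≤
      {A : Set α | A ⊆ M.E ∧ ((1 : ℕ) : ℕ∞) < M.eRk A ∧ M.eRk A < (p : ℕ∞)}.ncard * (p + 1) := by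
    calc (∑ u ∈ Finset.Ioo 1 p, (p + 1).choose u) *
          {A : Set α | A ⊆ M.E ∧ M.eRk A = (p : ℕ∞) ∧ M.eRk (M.E \ A) = ((1 : ℕ) : ℕ∞)}.ncard
        = ∑ u ∈ Finset.Ioo 1 p, (p + 1).choose u *
            {A : Set α | A ⊆ M.E ∧ M.eRk A = (p : ℕ∞) ∧ M.eRk (M.E \ A) = ((1 : ℕ) : ℕ∞)}.ncard :=
          Finset.sum_mul _ _ _
      _ ≤ ∑ u ∈ Finset.Ioo 1 p, (p + 1) * {S : Set α | S ⊆ M.E ∧ M.eRk S = (u : ℕ∞)}.ncard :=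
          Finset.sum_le_sum hlev
      _ = (p + 1) * ∑ u ∈ Finset.Ioo 1 p, {S : Set α | S ⊆ M.E ∧ M.eRk S = (u : ℕ∞)}.ncard :=
          (Finset.mul_sum _ _ _).symm
      _ ≤ (p + 1) * {A : Set α | A ⊆ M.E ∧ ((1 : ℕ) : ℕ∞) < M.eRk A ∧ M.eRk A < (p : ℕ∞)}.ncard :=
          Nat.mul_le_mul_left _ hsum
      _ = _ := mul_comm _ _
  unfold phiK
  rw [Nat.choose_succ_self_right, div_mul_eq_mul_div, div_le_iff₀ (by positivity)]
  exact_mod_cast hN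

/-- **C-025, THEOREM B: the `q = 1` case for EVERY finite matroid** (mine-2, MINE2-RLS.md §3; here by strong
induction on `|E|` — loops halve, a parallel pair is the Theorem F step with Theorem A on the contraction,
simple matroids are Theorem B′ summed): `Φ(p,1)·#{A ⊆ E : r(A) = p, r(E ∖ A) = 1} ≤ #{A ⊆ E : 1 < r(A) < p}`
— the `C025` body at `q = 1`, for every `p`. -/
theorem c025_of_q_one (M : Matroid α) [M.Finite] (p : ℕ) :
    phiK p 1 * ({A : Set α | A ⊆ M.E ∧ M.eRk A = (p : ℕ∞) ∧ M.eRk (M.E \ A) = ((1 : ℕ) : ℕ∞)}.ncard : ℚ) ≤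
      ({A : Set α | A ⊆ M.E ∧ ((1 : ℕ) : ℕ∞) < M.eRk A ∧ M.eRk A < (p : ℕ∞)}.ncard : ℚ) := by
  suffices h : ∀ n : ℕ, ∀ (N : Matroid α) [N.Finite], N.E.ncard = n →
      phiK p 1 * ({A : Set α | A ⊆ N.E ∧ N.eRk A = (p : ℕ∞) ∧ N.eRk (N.E \ A) = ((1 : ℕ) : ℕ∞)}.ncard : ℚ) ≤
        ({A : Set α | A ⊆ N.E ∧ ((1 : ℕ) : ℕ∞) < N.eRk A ∧ N.eRk A < (p : ℕ∞)}.ncard : ℚ) from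
    h _ M rfl
  intro n
  induction n using Nat.strong_induction_on with
  | _ n ih =>
    intro N _ hn
    by_cases hsimple : ∀ T ⊆ N.E, T.encard ≤ 2 → N.Indep T
    · exact c025_of_q_one_of_simple hsimple p
    rcases exists_loop_or_parallel_of_not_simple hsimple with ⟨e, he, -⟩ | ⟨e, e', heE, he'E, hne, heI, hpar⟩
    · -- a loop: both counts halve
      have heE : e ∈ N.E := N.loops_subset_ground he
      have hlt : (N ＼ {e}).E.ncard < n := by
        rw [Matroid.delete_ground, ← hn]
        exact ncard_sdiff_singleton_lt_of_mem heE (N.set_finite N.E)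
      have ih' := ih _ hlt (N ＼ {e}) rfl
      rw [ncard_U_eq_two_mul_of_loop he p 1, ncard_Y_eq_two_mul_of_loop he p 1, Nat.cast_mul,
        Nat.cast_mul, Nat.cast_ofNat]
      linarith [ih']
    · -- a parallel pair: the single-element step
      cases p with
      | zero =>
        have h0 : phiK 0 1 = 0 := by
          unfold phiK
          rw [Finset.sum_eq_zero (fun u hu => by rw [Finset.mem_Ioo] at hu; omega), zero_div]
        rw [h0, zero_mul]
        positivity
      | succ p' =>
        have hlt : (N ＼ {e}).E.ncard < n := by
          rw [Matroid.delete_ground, ← hn]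
          exact ncard_sdiff_singleton_lt_of_mem heE (N.set_finite N.E)
        have h1 := ih _ hlt (N ＼ {e}) rfl
        have h2 := c025_of_q_zero (M := N ／ {e}) p'
        exact c025_step_of_delete_contract heI (spans_of_parallel he'E hne hpar) p' 0 h1 h2

end PercRepro
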